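import Summits.HodgeConjecture.HodgeConjecture.Theorems.CyclicUnitaryPowersFiveFacts
import Summits.HodgeConjecture.HodgeConjecture.Theorems.CyclicUnitaryPowersDeckHodgeOfGriffiths

/-!
# Crux K1 `VeryGeneralDeckCommutatorsInHg` and the rung leaf `CyclicSurfacePowersHodge` modulo FOUR
# cited facts (route `CyclicUnitaryPowers`, items stmt-HodgeConjecture-19544 / 19543)

Prover seat `hodge-nonav-prover-Ax` (g4), cell `hodge-nonav`, 2026-08-27. Landed
`--supports stmt-HodgeConjecture-19544`; sorry-free, no definition, no new named fact. CONDITIONAL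
results; nothing here says HC ∕ HC_AV is proved; rung F-H1 is not moved.

The two conditional closings of K1 now in the tree are merged:

* `CyclicUnitaryPowersFiveFacts.veryGeneralDeckCommutatorsInHg_of_five_facts` (this seat): K1 from
  the Carlson–Toledo family, the two Carlson–Toledo Hodge-number facts
  (`carlsonToledo1999_finrank_eigenspace_deck_one`, `…_inf_hodgePiece`), the unitary-reflection
  density (CT Thm. 7.1) and the Cattani–Deligne–Kaplan cover — André's normality theorem and
  Deligne's CMSP 15.3.7 having been PROVED on the tree's carriers
  (`deligne_finiteIndex_monodromy_le_mumfordTateGroup_of_isQuasiProjectiveOver`) and bypassed;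
* `CyclicUnitaryPowersDeckHodgeOfGriffiths.carlsonToledo1999_finrank_eigenspace_deck_one_of_residueKernel`
  / `…_inf_hodgePiece_of_residueKernel` (prover-Bx g5): the two Hodge-number facts FOLLOW from
  Griffiths' residue-kernel theorem `Griffiths1969_residueKernel_eq_jacobianIdeal` (Voisin II
  Thm. 6.10 / Cor. 6.12) — the same named fact route `SignSymmetricPowers` binds
  (`SignSymmetricPowersSignDeckHodgeKernel.stub_signDeckHodge_of_residueKernel`).

Hence `veryGeneralDeckCommutatorsInHg_of_four_facts`: **K1 ⟸ {`nonempty_carlsonToledoFamily`,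
`Griffiths1969_residueKernel_eq_jacobianIdeal`, `carlsonToledo1999_unitaryReflection_zariskiDense`,
`cmsp_nonHodgeGenericPoints_countable_algebraic_cover`}**, and the rung leaf likewise
(`cyclicSurfacePowersHodge_of_four_facts`).

## References

* [CarlsonToledo1999] J. A. Carlson, D. Toledo, Discriminant complements and kernels of monodromy
  representations, Duke Math. J. 97 (1999), §§2, 3, 5, 6, Thm. 7.1.
* [VoisinHodgeII2003] C. Voisin, Hodge Theory and Complex Algebraic Geometry II (2003), §6.1.3
  Thm. 6.10 / Cor. 6.12.
* [CattaniDeligneKaplan1995] E. Cattani, P. Deligne, A. Kaplan, On the locus of Hodge classes,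
  J. Amer. Math. Soc. 8 (1995), Cor. 1.2.
-/

noncomputable section

open Literature.AlgebraicGeometry.Motives Literature.AlgebraicGeometry.HodgeTheory

-- mandated namespace `Summit.HodgeConjecture.HodgeConjecture.Theorems` trips `linter.dupNamespace` (off tree-wide)
set_option linter.dupNamespace false

namespace Summit.HodgeConjecture.HodgeConjecture.Theorems.CyclicUnitaryPowersFourFacts

/-- **Crux K1 `VeryGeneralDeckCommutatorsInHg` modulo FOUR cited facts**: the universal Carlson–Toledo
family of cyclic covers of the plane with its Picard–Lefschetz package (`nonempty_carlsonToledoFamily`,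
CT §§2, 3, 6), Griffiths' residue-kernel theorem (`Griffiths1969_residueKernel_eq_jacobianIdeal`,
Voisin II Thm. 6.10 / Cor. 6.12 — feeding BOTH Carlson–Toledo Hodge-number facts), the Zariski density
of the unitary reflection monodromy (`carlsonToledo1999_unitaryReflection_zariskiDense`, CT Thm. 7.1)
and the Cattani–Deligne–Kaplan countable algebraic cover of the non-Hodge-generic points
(`cmsp_nonHodgeGenericPoints_countable_algebraic_cover`). André 1992 and Deligne 1972 / CMSP 15.3.7
are theorems of the tree on this family and no longer inputs. CONDITIONAL; nothing here says
HC ∕ HC_AV is proved. [cite: CarlsonToledo1999, §2, §5, Thm. 7.1]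
[cite: VoisinHodgeII2003, §6.1.3 Thm. 6.10 and Cor. 6.12] -/
theorem veryGeneralDeckCommutatorsInHg_of_four_facts
    (hCT : nonempty_carlsonToledoFamily)
    (hG : Griffiths1969_residueKernel_eq_jacobianIdeal)
    (hCT71 : carlsonToledo1999_unitaryReflection_zariskiDense)
    (hCDK : cmsp_nonHodgeGenericPoints_countable_algebraic_cover) :
    Summit.HodgeConjecture.HodgeConjecture.Theses.CyclicUnitaryPowers.VeryGeneralDeckCommutatorsInHg :=
  CyclicUnitaryPowersFiveFacts.veryGeneralDeckCommutatorsInHg_of_five_facts @hCT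
    (CyclicUnitaryPowersDeckHodgeOfGriffiths.carlsonToledo1999_finrank_eigenspace_deck_one_of_residueKernel hG)
    (CyclicUnitaryPowersDeckHodgeOfGriffiths.carlsonToledo1999_finrank_eigenspace_inf_hodgePiece_of_residueKernel
      hG)
    @hCT71 @hCDK

/-- **The rung leaf `CyclicSurfacePowersHodge` modulo the same FOUR cited facts** (K1 above composed
with the PROVED crux K2 `PowersHodgeOfDeckCommutators` and support S through the tree's
`cyclicSurfacePowersHodge_of_veryGeneralDeckCommutatorsInHg`). CONDITIONAL; rung F-H1 not moved.
[cite: CarlsonToledo1999, §2, §5, Thm. 7.1] [cite: VoisinHodgeII2003, §6.1.3 Thm. 6.10 and Cor. 6.12] -/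
theorem cyclicSurfacePowersHodge_of_four_facts
    (hCT : nonempty_carlsonToledoFamily)
    (hG : Griffiths1969_residueKernel_eq_jacobianIdeal)
    (hCT71 : carlsonToledo1999_unitaryReflection_zariskiDense)
    (hCDK : cmsp_nonHodgeGenericPoints_countable_algebraic_cover) :
    Summit.HodgeConjecture.HodgeConjecture.Theses.CyclicUnitaryPowers.CyclicSurfacePowersHodge :=
  CyclicUnitaryPowersCyclicSurfacePowersHodge.cyclicSurfacePowersHodge_of_veryGeneralDeckCommutatorsInHg
    (veryGeneralDeckCommutatorsInHg_of_four_facts @hCT @hG @hCT71 @hCDK)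

end Summit.HodgeConjecture.HodgeConjecture.Theorems.CyclicUnitaryPowersFourFacts

end
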